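import Summits.CriticalPhenomena.Ising3DConformalLimit.Theses.IsingEuclidUpgrade
import Summits.CriticalPhenomena.Ising3DConformalLimit.Theorems.GapForcesFarMerging.Negative.SoftKernel
import Summits.CriticalPhenomena.Ising3DConformalLimit.Theorems.JoiningsTransfer.Negative.TwoBaseCroftMutations
import Summits.CriticalPhenomena.Ising3DConformalLimit.Theorems.PrecisionLaplacianDirectCorrelationStableTailExponentWindow
import Literature.Probability.LatticeModels.CriticalTwoPointBounds
import HarnessLib

/-!
# Crux `IsingEuclidUpgradeR2RotInvPowerLaw` (stmt-CriticalPhenomena-0634) — negative-side support, 0: bookkeeping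

Standing crux disprover (cdisprove cycle 1, 2026-08-17), THEOREM-ONLY file (no definitions, no named facts).
Shared lemmas for the gauge-witness files `Negative/LogPeriodicGauge.lean` (W2), `Negative/DriftingGauge.lean`
(W1), `Negative/QuarticAnisotropy.lean` (W3) — findings F1–F4 of
`Cruxes/IsingEuclidUpgradeR2RotInvPowerLaw/Disproof.lean`:

* axis / diagonal bookkeeping on `ℤ³` (`√Σ` of `n e₀` is `n`, of `(n,n,n)` is `√3 n`; cofinite limits restrict to
  the axis and to the diagonal);
* sup norm versus Euclidean radius (`1 ≤ ‖x‖ ≤ |x|₂ ≤ √3‖x‖` off the origin; floor radius bounds);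
* reused from the tree (imported, not restated): `one_le_norm_of_ne_zero` (GapForcesFarMerging/Negative), `cos_two_pi_logb_two_three_ne_one`
  (JoiningsTransfer/Negative), `expWin_norm_le_euclid`, `expWin_euclid_le_sqrt_three_mul_norm` (`‖x‖ ≤ |x|₂ ≤ √3‖x‖`);
* F1: the crux restricted to the axis is the axial pure power law, for the Ising two-point function itself
  (`axisPowerLaw_of_crux`), and the Ising two-point function lies in the `d = 3` envelope with numeral exponents
  (`criticalTwoPoint_envelope`).
-/

noncomputable section

namespace Summit.CriticalPhenomena.Ising3DConformalLimit.Theorems.IsingEuclidUpgradeR2RotInvPowerLaw.Negative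

open Filter Topology Literature.Probability.LatticeModels
open Summit.CriticalPhenomena.Ising3DConformalLimit.Theorems.GapForcesFarMerging.Negative (one_le_norm_of_ne_zero)
open Summit.CriticalPhenomena.Ising3DConformalLimit.JoiningsTransferNegative (cos_two_pi_logb_two_three_ne_one)
open Summit.CriticalPhenomena.Ising3DConformalLimit.Cruxes.DirectCorrelationStableTail.DiffusiveBranchIsNonsaturation
  (expWin_norm_le_euclid expWin_euclid_le_sqrt_three_mul_norm)

/-! ## Axis and diagonal bookkeeping -/

/-- `Σ xᵢ²` of the axis point `m e₀` is `m²`. -/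
theorem sum_sq_single (m : ℤ) :
    (∑ i : Fin 3, (((Pi.single (0 : Fin 3) m : Site 3) i : ℝ)) ^ 2) = (m : ℝ) ^ 2 := by
  simp [Pi.single_apply]

/-- `Σ xᵢ⁴` of the axis point `m e₀` is `m⁴`. -/
theorem sum_fourth_single (m : ℤ) :
    (∑ i : Fin 3, (((Pi.single (0 : Fin 3) m : Site 3) i : ℝ)) ^ 4) = (m : ℝ) ^ 4 := by
  simp [Pi.single_apply]

/-- The Euclidean radius of `n e₀` is `n`. -/
theorem sqrt_sum_sq_single_nat (n : ℕ) :
    Real.sqrt (∑ i : Fin 3, (((Pi.single (0 : Fin 3) ((n : ℕ) : ℤ) : Site 3) i : ℝ)) ^ 2) = n := by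
  rw [sum_sq_single]; push_cast; exact Real.sqrt_sq (Nat.cast_nonneg n)

/-- The floor radius of `n e₀` is `n`. -/
theorem floor_sqrt_sum_sq_single_nat (n : ℕ) :
    ⌊Real.sqrt (∑ i : Fin 3, (((Pi.single (0 : Fin 3) ((n : ℕ) : ℤ) : Site 3) i : ℝ)) ^ 2)⌋₊ = n := by
  rw [sqrt_sum_sq_single_nat, Nat.floor_natCast]

/-- `n ↦ n e₀` is injective. -/
theorem single_nat_injective :
    Function.Injective (fun n : ℕ => (Pi.single (0 : Fin 3) ((n : ℕ) : ℤ) : Site 3)) := by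
  intro a b h
  have := congrFun h 0
  simpa using this

/-- `n e₀ ≠ 0` for `n ≥ 1`. -/
theorem single_nat_ne_zero {n : ℕ} (hn : 1 ≤ n) : (Pi.single (0 : Fin 3) ((n : ℕ) : ℤ) : Site 3) ≠ 0 := by
  intro h
  have := congrFun h 0
  simp at this
  omega

/-- `m • e₀ = m e₀`. -/
theorem natCast_zsmul_single_one (m : ℕ) :
    ((((m : ℕ) : ℤ)) • (Pi.single (0 : Fin 3) ((1 : ℕ) : ℤ) : Site 3)) = Pi.single 0 ((m : ℕ) : ℤ) := by
  ext i
  simp [Pi.single_apply]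

/-- A cofinite limit on `ℤ³` restricts to a limit along the axis `n ↦ n e₀`. -/
theorem tendsto_axis_of_cofinite {F : Site 3 → ℝ} {l : Filter ℝ} (h : Tendsto F cofinite l) :
    Tendsto (fun n : ℕ => F (Pi.single 0 ((n : ℕ) : ℤ))) atTop l := by
  rw [← Nat.cofinite_eq_atTop]
  exact h.comp single_nat_injective.tendsto_cofinite

/-- `n ↦ (n,n,n)` is injective. -/
theorem diag_injective : Function.Injective (fun n : ℕ => (fun _ : Fin 3 => ((n : ℕ) : ℤ) : Site 3)) := by
  intro a b h
  have := congrFun h 0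
  simpa using this

/-- `(n,n,n) ≠ 0` for `n ≥ 1`. -/
theorem diag_ne_zero {n : ℕ} (hn : 1 ≤ n) : (fun _ : Fin 3 => ((n : ℕ) : ℤ) : Site 3) ≠ 0 := by
  intro h
  have := congrFun h 0
  simp at this
  omega

/-- `Σ xᵢ²` of `(n,n,n)` is `3n²`. -/
theorem sum_sq_diag (n : ℕ) :
    (∑ i : Fin 3, ((((fun _ : Fin 3 => ((n : ℕ) : ℤ)) : Site 3) i : ℝ)) ^ 2) = 3 * (n : ℝ) ^ 2 := by
  simp [Finset.sum_const, Finset.card_univ, Fintype.card_fin]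

/-- `Σ xᵢ⁴` of `(n,n,n)` is `3n⁴`. -/
theorem sum_fourth_diag (n : ℕ) :
    (∑ i : Fin 3, ((((fun _ : Fin 3 => ((n : ℕ) : ℤ)) : Site 3) i : ℝ)) ^ 4) = 3 * (n : ℝ) ^ 4 := by
  simp [Finset.sum_const, Finset.card_univ, Fintype.card_fin]

/-- The Euclidean radius of `(n,n,n)` is `√3·n`. -/
theorem sqrt_sum_sq_diag (n : ℕ) :
    Real.sqrt (∑ i : Fin 3, ((((fun _ : Fin 3 => ((n : ℕ) : ℤ)) : Site 3) i : ℝ)) ^ 2) = Real.sqrt 3 * n := by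
  rw [sum_sq_diag, Real.sqrt_mul' _ (sq_nonneg _), Real.sqrt_sq (Nat.cast_nonneg n)]

/-- A cofinite limit on `ℤ³` restricts to a limit along the diagonal `n ↦ (n,n,n)`. -/
theorem tendsto_diag_of_cofinite {F : Site 3 → ℝ} {l : Filter ℝ} (h : Tendsto F cofinite l) :
    Tendsto (fun n : ℕ => F (fun _ : Fin 3 => ((n : ℕ) : ℤ))) atTop l := by
  rw [← Nat.cofinite_eq_atTop]
  exact h.comp diag_injective.tendsto_cofinite

/-- `⌊√3·n⌋ / n → √3`. -/
theorem tendsto_floor_sqrt_three_mul_div :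
    Tendsto (fun n : ℕ => ((⌊Real.sqrt 3 * (n : ℝ)⌋₊ : ℕ) : ℝ) / (n : ℝ)) atTop (𝓝 (Real.sqrt 3)) := by
  have hs : (0 : ℝ) < Real.sqrt 3 := by positivity
  have h1 : Tendsto (fun n : ℕ => Real.sqrt 3 * (n : ℝ)) atTop atTop :=
    tendsto_natCast_atTop_atTop.const_mul_atTop hs
  have h2 := (tendsto_nat_floor_div_atTop (R := ℝ)).comp h1
  have h3 := h2.mul_const (Real.sqrt 3)
  rw [one_mul] at h3
  refine h3.congr' ?_
  filter_upwards [eventually_ge_atTop 1] with n hn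
  have hn0 : (n : ℝ) ≠ 0 := by exact_mod_cast (by omega : n ≠ 0)
  simp only [Function.comp_apply]
  field_simp

/-! ## Sup norm versus Euclidean radius on `ℤ³` -/

/-- Each squared coordinate is at most the squared sup norm. -/
theorem sq_coord_le_norm_sq (x : Site 3) (i : Fin 3) : ((x i : ℝ)) ^ 2 ≤ ‖x‖ ^ 2 := by
  have h1 : |(x i : ℝ)| ≤ ‖x‖ := by rw [← Int.norm_eq_abs]; exact norm_le_pi_norm x i
  nlinarith [abs_nonneg ((x i : ℝ)), sq_abs ((x i : ℝ))]

/-- `‖x‖² ≤ Σ xᵢ²`. -/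
theorem norm_sq_le_sum_sq (x : Site 3) : ‖x‖ ^ 2 ≤ ∑ i, ((x i : ℝ)) ^ 2 := by
  have h' : ‖x‖ ^ 2 ≤ Real.sqrt (∑ i, ((x i : ℝ)) ^ 2) ^ 2 := pow_le_pow_left₀ (norm_nonneg _) (expWin_norm_le_euclid x) 2
  rwa [Real.sq_sqrt (by positivity)] at h'

/-- `Σ xᵢ² ≤ 3‖x‖²`. -/
theorem sum_sq_le_three_mul_norm_sq (x : Site 3) : (∑ i, ((x i : ℝ)) ^ 2) ≤ 3 * ‖x‖ ^ 2 :=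
  calc (∑ i, ((x i : ℝ)) ^ 2) ≤ ∑ _i : Fin 3, ‖x‖ ^ 2 := Finset.sum_le_sum fun i _ => sq_coord_le_norm_sq x i
    _ = 3 * ‖x‖ ^ 2 := by simp

/-- The floor radius `n = ⌊|x|₂⌋` of `x ≠ 0`: `1 ≤ n`, `n ≤ |x|₂ ≤ 2n`. -/
theorem floor_radius_bounds {x : Site 3} (hx : x ≠ 0) :
    1 ≤ ⌊Real.sqrt (∑ i, ((x i : ℝ)) ^ 2)⌋₊ ∧
    ((⌊Real.sqrt (∑ i, ((x i : ℝ)) ^ 2)⌋₊ : ℕ) : ℝ) ≤ Real.sqrt (∑ i, ((x i : ℝ)) ^ 2) ∧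
    Real.sqrt (∑ i, ((x i : ℝ)) ^ 2) ≤ 2 * ((⌊Real.sqrt (∑ i, ((x i : ℝ)) ^ 2)⌋₊ : ℕ) : ℝ) := by
  set r := Real.sqrt (∑ i, ((x i : ℝ)) ^ 2) with hr
  have hr1 : 1 ≤ r := le_trans (one_le_norm_of_ne_zero hx) (expWin_norm_le_euclid x)
  have hn1 : 1 ≤ ⌊r⌋₊ := Nat.le_floor (by exact_mod_cast hr1)
  refine ⟨hn1, Nat.floor_le (by linarith), ?_⟩
  have hlt : r < (⌊r⌋₊ : ℝ) + 1 := Nat.lt_floor_add_one r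
  have hn1' : (1 : ℝ) ≤ (⌊r⌋₊ : ℝ) := by exact_mod_cast hn1
  linarith

/-- Cubic symmetry of `Σ xᵢ²` under signed coordinate permutations. -/
theorem sum_sq_symm (σ : Equiv.Perm (Fin 3)) (ε : Fin 3 → ℤ) (hε : ∀ i, ε i = 1 ∨ ε i = -1) (x : Site 3) :
    (∑ i, (((ε i * x (σ i) : ℤ) : ℝ)) ^ 2) = ∑ i, ((x i : ℝ)) ^ 2 := by
  have : ∀ i, (((ε i * x (σ i) : ℤ) : ℝ)) ^ 2 = ((x (σ i) : ℝ)) ^ 2 := fun i => by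
    rcases hε i with h | h <;> simp [h]
  simp_rw [this]
  exact Equiv.sum_comp σ (fun j => ((x j : ℝ)) ^ 2)

/-- Cubic symmetry of `Σ xᵢ⁴` under signed coordinate permutations. -/
theorem sum_fourth_symm (σ : Equiv.Perm (Fin 3)) (ε : Fin 3 → ℤ) (hε : ∀ i, ε i = 1 ∨ ε i = -1) (x : Site 3) :
    (∑ i, (((ε i * x (σ i) : ℤ) : ℝ)) ^ 4) = ∑ i, ((x i : ℝ)) ^ 4 := by
  have : ∀ i, (((ε i * x (σ i) : ℤ) : ℝ)) ^ 4 = ((x (σ i) : ℝ)) ^ 4 := fun i => by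
    rcases hε i with h | h
    · simp [h]
    · simp [h]; ring
  simp_rw [this]
  exact Equiv.sum_comp σ (fun j => ((x j : ℝ)) ^ 4)

/-! ## Two constants -/

/-- `2 ^ s = 2 ^ t` forces `s = t` (real exponents). -/
theorem rpow_two_inj {s t : ℝ} (h : (2 : ℝ) ^ s = (2 : ℝ) ^ t) : s = t := by
  have := congrArg (Real.logb 2) h
  rwa [Real.logb_rpow two_pos (by norm_num), Real.logb_rpow two_pos (by norm_num)] at this

/-! ## F1: the crux on the axis; the Ising two-point function in the envelope -/

/-- F1. The crux restricted to the axis `n e₀` is the axial pure power law D1 (for the Ising two-point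
function; the same one-line argument works for any `G`). [folklore] -/
theorem axisPowerLaw_of_crux (h : Theses.IsingEuclidUpgrade.IsingEuclidUpgradeR2RotInvPowerLaw) :
    ∃ Δ c : ℝ, 0 < c ∧ Tendsto (fun n : ℕ => criticalTwoPoint 3 (Pi.single 0 ((n : ℕ) : ℤ)) * (n : ℝ) ^ (2 * Δ))
      atTop (𝓝 c) := by
  obtain ⟨Δ, c, hc, h⟩ := h
  refine ⟨Δ, c, hc, ?_⟩
  refine (tendsto_axis_of_cofinite h).congr fun n => ?_
  simp only [sqrt_sum_sq_single_nat]

/-- F1. The envelope of the tree at `d = 3` with numeral exponents: `c‖x‖⁻² ≤ ⟨σ₀σ_x⟩_{β_c} ≤ C‖x‖⁻¹`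
(`criticalTwoPoint_bounds_holds`). [cite: DuminilCopin2019, Thm. 4.8, §4.4] -/
theorem criticalTwoPoint_envelope :
    ∃ c C : ℝ, 0 < c ∧ ∀ x : Site 3, x ≠ 0 →
      c * (‖x‖ : ℝ) ^ (-(2 : ℝ)) ≤ criticalTwoPoint 3 x ∧ criticalTwoPoint 3 x ≤ C * (‖x‖ : ℝ) ^ (-(1 : ℝ)) := by
  obtain ⟨c, C, hc, h⟩ := criticalTwoPoint_bounds_holds (d := 3) le_rfl
  refine ⟨c, C, hc, fun x hx => ⟨?_, ?_⟩⟩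
  · convert (h x hx).1 using 3; norm_num
  · convert (h x hx).2 using 3; norm_num

end Summit.CriticalPhenomena.Ising3DConformalLimit.Theorems.IsingEuclidUpgradeR2RotInvPowerLaw.Negative

end
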